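import Summits.QuantumFields.YangMills.Theorems.PencilRigidityDiagonalMirrorRPRCentreClosed
import Summits.QuantumFields.YangMills.Theses.IsotropyFromPowerCounting

/-!
# Crux `DiagonalMirrorRPR` (stmt-QuantumFields-10604): subsequence stability of the package and the sign dichotomy

Crux `DiagonalMirrorRPR` of the routes `PencilRigidity`, `MirrorModularBoosts` and `IsotropyFromPowerCounting` of `YangMills`
(shared verbatim): for every compact simple `G`, lattice representation `r`, scheme `sch` and one-species family `S₁` with
the curvature package `W₁ r sch S₁` (`CurvaturePackage`), `S₁` is reflection positive in pull-back form in the four diagonal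
frames (`DiagonalFrameRP`).

Two structural facts about the crux AS TYPED, used to sharpen its registered residual (lead c8, line `centre-twisted-swap`):

* `exists_reindex` — **subsequence stability.**  `CurvaturePackage r sch S₁` (and `CoverInsensitivityOffDiag r sch`) pass to the
  scheme re-indexed along any strictly monotone `φ : ℕ → ℕ` (every clause is an `atTop`-statement in the step `k`, or does not
  mention `k`), with the SAME family `S₁`; the conclusion `DiagonalFrameRP S₁` does not mention the scheme at all.
* `exists_reindex_sign` — **sign dichotomy.**  Hence, for the purpose of proving the crux, the couplings may be assumed of one
  sign at EVERY step: `∀ k, 0 ≤ β_k` (extract the non-negative steps when there are infinitely many) or `∀ k, β_k < 0` (shift past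
  the last non-negative one).
* `DiagonalMirrorRPR_of_signedTransport` (+ the `MirrorModularBoosts` / `IsotropyFromPowerCounting` copies) — the crux follows from
  three statements each WEAKER than the corresponding registered stub of `Lines/centre_twisted_swap_residual.lean`
  (`reshaped_of_registered_T`, `…_Tc`, `…_N`): cover transport for pointwise non-negative couplings (T⁺), cover transport for
  centre data at pointwise negative couplings (T_c⁻), and the scope statement for centre-blind data at pointwise negative
  couplings (N⁻) — the landed closures `ParityBridgeColdTraces.Reduction.diagonalFrameRP_of_coverInsensitivityOffDiag` and
  `CentreTwistedSwap.Reduction.diagonalFrameRP_of_centre` (with S4'' = the landed `CentreTwistedSwap.stub_rpClosureTwisted`) do the rest.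

So the negative-coupling content of the crux as typed is exactly the regime `∀ k, β_k < 0` (no diagonal Schur cut of Wilson's
weight on any volume), vacuous once the Statement's `sch.HasWeakCouplingLimit` is threaded into `W₁`
(`CentreTwistedSwap.Reduction.eventually_beta_nonneg_of_hasWeakCouplingLimit`).  No definitions.  References: Fröhlich–Israel–Lieb–Simon,
Comm. Math. Phys. 62 (1978) Thm 2.1; Osterwalder–Seiler, Ann. Phys. 110 (1978) §2.
-/

set_option autoImplicit false

noncomputable section

open scoped SchwartzMap
open MeasureTheory Filter Topology
open Literature.MathematicalPhysics.QuantumLattice Literature.MathematicalPhysics.AQFT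
  Literature.MathematicalPhysics.QuantumFieldTheory

namespace Summit.QuantumFields.YangMills.Cruxes.DiagonalMirrorRPR.CentreTwistedSwap.SignDichotomy

open ParityBridgeColdTraces ParityBridgeColdTraces.Reduction CentreTwistedSwap.Reduction

variable {G : Type} [Group G] [TopologicalSpace G] [IsTopologicalGroup G] [CompactSpace G]
  [MeasurableSpace G] [BorelSpace G]

/-! ## §1 Subsequence stability of the package -/

/-- **Re-indexing lemma.**  If the curvature package holds along `sch`, then along the scheme re-indexed by a strictly
monotone `φ` (spacings `a_{φ k}`, couplings `β_{φ k}`, half-sides `L_{φ k}`, renormalisations `c(φ k), m(φ k)`) it holds with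
the same family `S₁`; cover insensitivity (off-diagonal) is inherited as well. -/
theorem exists_reindex (r : LatticeRep G) (sch : SpeciesScheme (YMSpecies G)) (S₁ : SchwingerFamily E4)
    (hW : CurvaturePackage r sch S₁) {φ : ℕ → ℕ} (hφ : StrictMono φ) :
    ∃ sch' : SpeciesScheme (YMSpecies G), (∀ k, sch'.β k = sch.β (φ k)) ∧ (∀ k, sch'.side k = sch.side (φ k)) ∧
      CurvaturePackage r sch' S₁ ∧ (CoverInsensitivityOffDiag r sch → CoverInsensitivityOffDiag r sch') := by
  let sch' : SpeciesScheme (YMSpecies G) :=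
    { a := fun k => sch.a (φ k)
      a_pos := fun k => sch.a_pos (φ k)
      tendsto_a := sch.tendsto_a.comp hφ.tendsto_atTop
      β := fun k => sch.β (φ k)
      L := fun k => sch.L (φ k)
      tendsto_L := sch.tendsto_L.comp hφ.tendsto_atTop
      c := fun s k => sch.c s (φ k)
      m := fun s k => sch.m s (φ k) }
  have hlat : ∀ (k n : ℕ) (f : Fin n → 𝓢(E4, ℝ)),
      latticeSchwinger r.ρ sch' (fun s => s.F) k n (fun _ => r.curvature) f =
        latticeSchwinger r.ρ sch (fun s => s.F) (φ k) n (fun _ => r.curvature) f := fun _ _ _ => rfl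
  have hcov : ∀ (k n : ℕ) (f : Fin n → 𝓢(E4, ℝ)),
      coverSchwinger r sch' k n f = coverSchwinger r sch (φ k) n f := fun _ _ _ => rfl
  refine ⟨sch', fun _ => rfl, fun _ => rfl, ?_, ?_⟩
  · obtain ⟨hconv, hOS, htr, hrot, Δ, hΔ, hgap, hlg⟩ := hW
    refine ⟨fun n hn f F hT hO => ?_, hOS, htr, hrot, Δ, hΔ, hgap, fun A B => ?_⟩
    · have h := (hconv n hn f F hT hO).comp hφ.tendsto_atTop
      refine h.congr fun k => ?_
      simp only [Function.comp_apply, hlat]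
    · obtain ⟨C, hC⟩ := hlg A B
      exact ⟨C, hφ.tendsto_atTop.eventually hC⟩
  · intro hCI n hn f hcs hdisj
    have h := (hCI n hn f hcs hdisj).comp hφ.tendsto_atTop
    refine h.congr fun k => ?_
    simp only [Function.comp_apply, hlat, hcov]

/-! ## §2 The sign dichotomy -/

/-- **Sign dichotomy.**  If the curvature package holds along `sch`, it holds (with the same `S₁`, and inheriting cover
insensitivity) along a re-indexed scheme whose couplings are either non-negative at EVERY step or negative at EVERY step. -/
theorem exists_reindex_sign (r : LatticeRep G) (sch : SpeciesScheme (YMSpecies G)) (S₁ : SchwingerFamily E4)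
    (hW : CurvaturePackage r sch S₁) :
    ∃ sch' : SpeciesScheme (YMSpecies G), CurvaturePackage r sch' S₁ ∧
      (CoverInsensitivityOffDiag r sch → CoverInsensitivityOffDiag r sch') ∧
      ((∀ k, 0 ≤ sch'.β k) ∨ (∀ k, sch'.β k < 0)) := by
  by_cases h : ∃ᶠ k in atTop, 0 ≤ sch.β k
  · obtain ⟨φ, hφ, hφ'⟩ := extraction_of_frequently_atTop h
    obtain ⟨sch', hβ, -, hW', hCI'⟩ := exists_reindex r sch S₁ hW hφ
    exact ⟨sch', hW', hCI', Or.inl fun k => by rw [hβ]; exact hφ' k⟩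
  · have hev : ∀ᶠ k in atTop, sch.β k < 0 := by
      simpa only [Filter.not_frequently, not_le] using h
    obtain ⟨k₀, hk₀⟩ := eventually_atTop.1 hev
    have hφ : StrictMono fun k : ℕ => k + k₀ := fun a b hab => Nat.add_lt_add_right hab k₀
    obtain ⟨sch', hβ, -, hW', hCI'⟩ := exists_reindex r sch S₁ hW hφ
    exact ⟨sch', hW', hCI', Or.inr fun k => by rw [hβ]; exact hk₀ _ (Nat.le_add_left k₀ k)⟩

/-! ## §3 The crux from signed transport + signed scope -/

/-- **The crux from the sharpened residual** (`PencilRigidity` copy, by name).  If (T⁺) the package with couplings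
non-negative at every step gives cover insensitivity on off-diagonal compact real families, (T_c⁻) the same for centre data
(`r.ρ z = −𝟙`, `z ∈ Z(G)`) with couplings negative at every step, and (N⁻) the crux holds for centre-blind data with couplings
negative at every step, then `DiagonalMirrorRPR` holds.  Proof: sign dichotomy (`exists_reindex_sign`), then the landed
closures (trivial twist for `β ≥ 0`, centre twist for `β < 0`). -/
theorem DiagonalMirrorRPR_of_signedTransport
    (hT : ∀ (G : Type) [Group G] [TopologicalSpace G] [IsTopologicalGroup G] [CompactSpace G]
      [MeasurableSpace G] [BorelSpace G], IsCompactSimpleLieGroup G →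
      ∀ (r : LatticeRep G) (sch : SpeciesScheme (YMSpecies G)) (S₁ : SchwingerFamily E4),
        CurvaturePackage r sch S₁ → (∀ k, 0 ≤ sch.β k) → CoverInsensitivityOffDiag r sch)
    (hTc : ∀ (G : Type) [Group G] [TopologicalSpace G] [IsTopologicalGroup G] [CompactSpace G]
      [MeasurableSpace G] [BorelSpace G], IsCompactSimpleLieGroup G →
      ∀ (r : LatticeRep G) (sch : SpeciesScheme (YMSpecies G)) (S₁ : SchwingerFamily E4),
        CurvaturePackage r sch S₁ → (∃ z ∈ Subgroup.center G, r.ρ z = -1) → (∀ k, sch.β k < 0) →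
          CoverInsensitivityOffDiag r sch)
    (hN : ∀ (G : Type) [Group G] [TopologicalSpace G] [IsTopologicalGroup G] [CompactSpace G]
      [MeasurableSpace G] [BorelSpace G], IsCompactSimpleLieGroup G →
      ∀ (r : LatticeRep G) (sch : SpeciesScheme (YMSpecies G)) (S₁ : SchwingerFamily E4),
        CurvaturePackage r sch S₁ → (¬ ∃ z ∈ Subgroup.center G, r.ρ z = -1) → (∀ k, sch.β k < 0) →
          DiagonalFrameRP S₁) :
    Summit.QuantumFields.YangMills.Theses.PencilRigidity.DiagonalMirrorRPR := by
  -- readback: the decl is definitionally `∀ G simple, r, sch, S₁: CurvaturePackage → DiagonalFrameRP`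
  have hiff : Summit.QuantumFields.YangMills.Theses.PencilRigidity.DiagonalMirrorRPR ↔
      ∀ (G : Type) [Group G] [TopologicalSpace G] [IsTopologicalGroup G] [CompactSpace G],
        IsCompactSimpleLieGroup G →
          letI : MeasurableSpace G := borel G
          haveI : BorelSpace G := ⟨rfl⟩
          ∀ (r : LatticeRep G) (sch : SpeciesScheme (YMSpecies G)) (S₁ : SchwingerFamily E4),
            CurvaturePackage r sch S₁ → DiagonalFrameRP S₁ := Iff.rfl
  refine hiff.mpr ?_
  intro G _ _ _ _ hG
  letI : MeasurableSpace G := borel G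
  haveI : BorelSpace G := ⟨rfl⟩
  intro r sch S₁ hW
  obtain ⟨sch', hW', -, hsign⟩ := exists_reindex_sign r sch S₁ hW
  rcases hsign with hpos | hneg
  · exact diagonalFrameRP_of_coverInsensitivityOffDiag hG r sch' S₁ hW' (Eventually.of_forall hpos)
      (hT G hG r sch' S₁ hW' hpos)
  · by_cases hz : ∃ z ∈ Subgroup.center G, r.ρ z = -1
    · exact diagonalFrameRP_of_centre stub_rpClosureTwisted hG r sch' S₁ hW' hz (hTc G hG r sch' S₁ hW' hz hneg)
    · exact hN G hG r sch' S₁ hW' hz hneg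

/-- The same composition for the item's recorded decl, the `MirrorModularBoosts` copy (the same proposition). -/
theorem DiagonalMirrorRPR_mmb_of_signedTransport
    (hT : ∀ (G : Type) [Group G] [TopologicalSpace G] [IsTopologicalGroup G] [CompactSpace G]
      [MeasurableSpace G] [BorelSpace G], IsCompactSimpleLieGroup G →
      ∀ (r : LatticeRep G) (sch : SpeciesScheme (YMSpecies G)) (S₁ : SchwingerFamily E4),
        CurvaturePackage r sch S₁ → (∀ k, 0 ≤ sch.β k) → CoverInsensitivityOffDiag r sch)
    (hTc : ∀ (G : Type) [Group G] [TopologicalSpace G] [IsTopologicalGroup G] [CompactSpace G]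
      [MeasurableSpace G] [BorelSpace G], IsCompactSimpleLieGroup G →
      ∀ (r : LatticeRep G) (sch : SpeciesScheme (YMSpecies G)) (S₁ : SchwingerFamily E4),
        CurvaturePackage r sch S₁ → (∃ z ∈ Subgroup.center G, r.ρ z = -1) → (∀ k, sch.β k < 0) →
          CoverInsensitivityOffDiag r sch)
    (hN : ∀ (G : Type) [Group G] [TopologicalSpace G] [IsTopologicalGroup G] [CompactSpace G]
      [MeasurableSpace G] [BorelSpace G], IsCompactSimpleLieGroup G →
      ∀ (r : LatticeRep G) (sch : SpeciesScheme (YMSpecies G)) (S₁ : SchwingerFamily E4),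
        CurvaturePackage r sch S₁ → (¬ ∃ z ∈ Subgroup.center G, r.ρ z = -1) → (∀ k, sch.β k < 0) →
          DiagonalFrameRP S₁) :
    Summit.QuantumFields.YangMills.Theses.MirrorModularBoosts.DiagonalMirrorRPR := by
  have h : Summit.QuantumFields.YangMills.Theses.PencilRigidity.DiagonalMirrorRPR ↔
      Summit.QuantumFields.YangMills.Theses.MirrorModularBoosts.DiagonalMirrorRPR := Iff.rfl
  exact h.mp (DiagonalMirrorRPR_of_signedTransport hT hTc hN)

/-- The same composition for the `IsotropyFromPowerCounting` copy (the same proposition). -/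
theorem DiagonalMirrorRPR_isotropy_of_signedTransport
    (hT : ∀ (G : Type) [Group G] [TopologicalSpace G] [IsTopologicalGroup G] [CompactSpace G]
      [MeasurableSpace G] [BorelSpace G], IsCompactSimpleLieGroup G →
      ∀ (r : LatticeRep G) (sch : SpeciesScheme (YMSpecies G)) (S₁ : SchwingerFamily E4),
        CurvaturePackage r sch S₁ → (∀ k, 0 ≤ sch.β k) → CoverInsensitivityOffDiag r sch)
    (hTc : ∀ (G : Type) [Group G] [TopologicalSpace G] [IsTopologicalGroup G] [CompactSpace G]
      [MeasurableSpace G] [BorelSpace G], IsCompactSimpleLieGroup G →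
      ∀ (r : LatticeRep G) (sch : SpeciesScheme (YMSpecies G)) (S₁ : SchwingerFamily E4),
        CurvaturePackage r sch S₁ → (∃ z ∈ Subgroup.center G, r.ρ z = -1) → (∀ k, sch.β k < 0) →
          CoverInsensitivityOffDiag r sch)
    (hN : ∀ (G : Type) [Group G] [TopologicalSpace G] [IsTopologicalGroup G] [CompactSpace G]
      [MeasurableSpace G] [BorelSpace G], IsCompactSimpleLieGroup G →
      ∀ (r : LatticeRep G) (sch : SpeciesScheme (YMSpecies G)) (S₁ : SchwingerFamily E4),
        CurvaturePackage r sch S₁ → (¬ ∃ z ∈ Subgroup.center G, r.ρ z = -1) → (∀ k, sch.β k < 0) →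
          DiagonalFrameRP S₁) :
    Summit.QuantumFields.YangMills.Theses.IsotropyFromPowerCounting.DiagonalMirrorRPR := by
  have h : Summit.QuantumFields.YangMills.Theses.PencilRigidity.DiagonalMirrorRPR ↔
      Summit.QuantumFields.YangMills.Theses.IsotropyFromPowerCounting.DiagonalMirrorRPR := Iff.rfl
  exact h.mp (DiagonalMirrorRPR_of_signedTransport hT hTc hN)

/-! ## §4 The sharpened statements are implied by the registered stubs of record -/

/-- T⁺ is implied by the registered T (`stub_coverTransportOffDiag`: eventually non-negative couplings). -/
theorem reshaped_of_registered_T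
    (hT : ∀ (G : Type) [Group G] [TopologicalSpace G] [IsTopologicalGroup G] [CompactSpace G]
      [MeasurableSpace G] [BorelSpace G], IsCompactSimpleLieGroup G →
      ∀ (r : LatticeRep G) (sch : SpeciesScheme (YMSpecies G)) (S₁ : SchwingerFamily E4),
        CurvaturePackage r sch S₁ → (∀ᶠ k in atTop, 0 ≤ sch.β k) → CoverInsensitivityOffDiag r sch) :
    ∀ (G : Type) [Group G] [TopologicalSpace G] [IsTopologicalGroup G] [CompactSpace G]
      [MeasurableSpace G] [BorelSpace G], IsCompactSimpleLieGroup G →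
      ∀ (r : LatticeRep G) (sch : SpeciesScheme (YMSpecies G)) (S₁ : SchwingerFamily E4),
        CurvaturePackage r sch S₁ → (∀ k, 0 ≤ sch.β k) → CoverInsensitivityOffDiag r sch :=
  fun G _ _ _ _ _ _ hG r sch S₁ hW hpos => hT G hG r sch S₁ hW (Eventually.of_forall hpos)

/-- T_c⁻ is implied by the registered T_c (`stub_coverTransportCentre`: centre data, all signs). -/
theorem reshaped_of_registered_Tc
    (hTc : ∀ (G : Type) [Group G] [TopologicalSpace G] [IsTopologicalGroup G] [CompactSpace G]
      [MeasurableSpace G] [BorelSpace G], IsCompactSimpleLieGroup G →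
      ∀ (r : LatticeRep G) (sch : SpeciesScheme (YMSpecies G)) (S₁ : SchwingerFamily E4),
        CurvaturePackage r sch S₁ → (∃ z ∈ Subgroup.center G, r.ρ z = -1) → CoverInsensitivityOffDiag r sch) :
    ∀ (G : Type) [Group G] [TopologicalSpace G] [IsTopologicalGroup G] [CompactSpace G]
      [MeasurableSpace G] [BorelSpace G], IsCompactSimpleLieGroup G →
      ∀ (r : LatticeRep G) (sch : SpeciesScheme (YMSpecies G)) (S₁ : SchwingerFamily E4),
        CurvaturePackage r sch S₁ → (∃ z ∈ Subgroup.center G, r.ρ z = -1) → (∀ k, sch.β k < 0) →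
          CoverInsensitivityOffDiag r sch :=
  fun G _ _ _ _ _ _ hG r sch S₁ hW hz _ => hTc G hG r sch S₁ hW hz

/-- N⁻ is implied by the registered N' (`stub_centreBlindNegativeScope`: `β_k < 0` frequently). -/
theorem reshaped_of_registered_N
    (hN : ∀ (G : Type) [Group G] [TopologicalSpace G] [IsTopologicalGroup G] [CompactSpace G]
      [MeasurableSpace G] [BorelSpace G], IsCompactSimpleLieGroup G →
      ∀ (r : LatticeRep G) (sch : SpeciesScheme (YMSpecies G)) (S₁ : SchwingerFamily E4),
        CurvaturePackage r sch S₁ → (¬ ∃ z ∈ Subgroup.center G, r.ρ z = -1) → (∃ᶠ k in atTop, sch.β k < 0) →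
          DiagonalFrameRP S₁) :
    ∀ (G : Type) [Group G] [TopologicalSpace G] [IsTopologicalGroup G] [CompactSpace G]
      [MeasurableSpace G] [BorelSpace G], IsCompactSimpleLieGroup G →
      ∀ (r : LatticeRep G) (sch : SpeciesScheme (YMSpecies G)) (S₁ : SchwingerFamily E4),
        CurvaturePackage r sch S₁ → (¬ ∃ z ∈ Subgroup.center G, r.ρ z = -1) → (∀ k, sch.β k < 0) →
          DiagonalFrameRP S₁ :=
  fun G _ _ _ _ _ _ hG r sch S₁ hW hz hneg => hN G hG r sch S₁ hW hz (Frequently.of_forall hneg)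

/-- **Consistency with the residual of record.**  The registered triple T (`stub_coverTransportOffDiag`), T_c
(`stub_coverTransportCentre`), N' (`stub_centreBlindNegativeScope`) of c3/c7 implies the crux through the sharpened composition
(so the reshape T⁺ / T_c⁻ / N⁻ loses nothing: it is the same residual with each statement weakened) — stated for the third
wanting route's copy `IsotropyFromPowerCounting.DiagonalMirrorRPR` (for the other two copies this is the landed
`CentreTwistedSwap.Reduction.DiagonalMirrorRPR_of_transport` / `stub_crux_of_transport`). -/
theorem DiagonalMirrorRPR_isotropy_of_registeredTransport
    (hT : ∀ (G : Type) [Group G] [TopologicalSpace G] [IsTopologicalGroup G] [CompactSpace G]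
      [MeasurableSpace G] [BorelSpace G], IsCompactSimpleLieGroup G →
      ∀ (r : LatticeRep G) (sch : SpeciesScheme (YMSpecies G)) (S₁ : SchwingerFamily E4),
        CurvaturePackage r sch S₁ → (∀ᶠ k in atTop, 0 ≤ sch.β k) → CoverInsensitivityOffDiag r sch)
    (hTc : ∀ (G : Type) [Group G] [TopologicalSpace G] [IsTopologicalGroup G] [CompactSpace G]
      [MeasurableSpace G] [BorelSpace G], IsCompactSimpleLieGroup G →
      ∀ (r : LatticeRep G) (sch : SpeciesScheme (YMSpecies G)) (S₁ : SchwingerFamily E4),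
        CurvaturePackage r sch S₁ → (∃ z ∈ Subgroup.center G, r.ρ z = -1) → CoverInsensitivityOffDiag r sch)
    (hN : ∀ (G : Type) [Group G] [TopologicalSpace G] [IsTopologicalGroup G] [CompactSpace G]
      [MeasurableSpace G] [BorelSpace G], IsCompactSimpleLieGroup G →
      ∀ (r : LatticeRep G) (sch : SpeciesScheme (YMSpecies G)) (S₁ : SchwingerFamily E4),
        CurvaturePackage r sch S₁ → (¬ ∃ z ∈ Subgroup.center G, r.ρ z = -1) → (∃ᶠ k in atTop, sch.β k < 0) →
          DiagonalFrameRP S₁) :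
    Summit.QuantumFields.YangMills.Theses.IsotropyFromPowerCounting.DiagonalMirrorRPR :=
  DiagonalMirrorRPR_isotropy_of_signedTransport (reshaped_of_registered_T hT) (reshaped_of_registered_Tc hTc)
    (reshaped_of_registered_N hN)

/-! ## §5 Registered sub-goal of the item (verbatim one-line header; `ledger workitem stub-add`) -/

/-- **Registered sub-goal `stub_signDichotomy_reduction`** (the composition of the reshaped skeleton
`Cruxes/DiagonalMirrorRPR/Lines/centre_twisted_swap_residual.lean`, lead c8): T⁺ → T_c⁻ → N⁻ → the crux (the item's recorded decl, the
`MirrorModularBoosts` copy). -/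
theorem stub_signDichotomy_reduction : (∀ (G : Type) [Group G] [TopologicalSpace G] [IsTopologicalGroup G] [CompactSpace G] [MeasurableSpace G] [BorelSpace G], IsCompactSimpleLieGroup G → ∀ (r : LatticeRep G) (sch : SpeciesScheme (YMSpecies G)) (S₁ : SchwingerFamily E4), CurvaturePackage r sch S₁ → (∀ k, 0 ≤ sch.β k) → CoverInsensitivityOffDiag r sch) → (∀ (G : Type) [Group G] [TopologicalSpace G] [IsTopologicalGroup G] [CompactSpace G] [MeasurableSpace G] [BorelSpace G], IsCompactSimpleLieGroup G → ∀ (r : LatticeRep G) (sch : SpeciesScheme (YMSpecies G)) (S₁ : SchwingerFamily E4), CurvaturePackage r sch S₁ → (∃ z ∈ Subgroup.center G, r.ρ z = -1) → (∀ k, sch.β k < 0) → CoverInsensitivityOffDiag r sch) → (∀ (G : Type) [Group G] [TopologicalSpace G] [IsTopologicalGroup G] [CompactSpace G] [MeasurableSpace G] [BorelSpace G], IsCompactSimpleLieGroup G → ∀ (r : LatticeRep G) (sch : SpeciesScheme (YMSpecies G)) (S₁ : SchwingerFamily E4), CurvaturePackage r sch S₁ → (¬ ∃ z ∈ Subgroup.center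 G, r.ρ z = -1) → (∀ k, sch.β k < 0) → DiagonalFrameRP S₁) → Summit.QuantumFields.YangMills.Theses.MirrorModularBoosts.DiagonalMirrorRPR :=
  fun hT hTc hN => DiagonalMirrorRPR_mmb_of_signedTransport hT hTc hN

end Summit.QuantumFields.YangMills.Cruxes.DiagonalMirrorRPR.CentreTwistedSwap.SignDichotomy

end
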